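import Summits.BirchSwinnertonDyer.BirchSwinnertonDyer.Theorems.ManinLocalTwoThreeManinPrimeToAdditiveFiveLeOptimalPartner
import Summits.BirchSwinnertonDyer.Rank1Residual.ManinAdditive.TwistOrbitManinTransportProof
import Summits.BirchSwinnertonDyer.Rank1Residual.Additive.GordTwistMinimalModel
import Summits.BirchSwinnertonDyer.Rank1Residual.Additive.TwistRamTransport
import Literature.NumberTheory.EllipticCurves.GlobalMinimalModelProofs
import Literature.NumberTheory.EllipticCurves.QuadraticTwistJInvariantProofs
import Literature.NumberTheory.EllipticCurves.IsogenyCompProofs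
import Literature.NumberTheory.EllipticCurves.IsogenyDualProofs
import Literature.NumberTheory.EllipticCurves.IsogenyVariableChangeProofs
import Literature.NumberTheory.DiophantineGeometry.StewartYuPadicLogFormsReductionProofs
import HarnessLib

/-!
# Route `ManinLocalTwoThree`, residual crux C5 `ManinPrimeToAdditiveFiveLe`
# (stmt-BirchSwinnertonDyer-22969), line `upper_anchor`: **irreducibility-free Manin transport along a
# `χ_{p*}`-twist from an UNSTARRED curve, and the transfer of global twist-minimality along `W ∼ W₀ ⊗ χ_{p*}`**

Piece θ (part 1 of 2) of the width seat (HOME STATUS 2026-08-28, after the lead's DONE 08:13:39Z;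
line-first: tools for the registered stub `stub_red57sharp` of skeleton v4 4cca099bd9a9, consumed by the
sequel `…RedFiveSevenSharpSplit`). The line's original idea (`upper_anchor`: the upper member of a
`χ_{p*}`-twist pair inherits `p ∤ c` from the lower one) needed `E[p]` irreducible only to make optimality
commute with twisting; the transport itself — cell `pub/bsd-f2-manin` (an lens), `TwistOrbitManinTransport`,
PROVED for `χ_{q*}` as `twistOrbitManinTransport_pStar` (Stevens (5.2), (5.4)) — is irreducibility-free:
for `W₀` globally minimal with ANY conductor-level datum `D₀`, `C` a globally minimal model of
`W₀ ⊗ χ_{p*}` with `Δ(C) = (p*)⁶ Δ(W₀)`, and `W ∼ C` globally minimal with a LATTICE-OPTIMAL conductor-level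
datum `D` at the same conductor: `c(D) ∣ c(D₀)`.

* §1 `Δ_eq_pStar_pow_six_mul_Δ_of_padicValInt_lt_six` — the discriminant clause is automatic when
  `ord_p Δ_min(W₀) < 6` (UNSTARRED at `p`): every globally minimal model `C = u • (W₀ ⊗ χ_{p*})` has
  `u = ±1` (`ord_p u = 0`: both equations are `p`-minimal, tree `padicValRat_u_eq_zero_of_twist_pm_p_of_lt_six`;
  `ord_ℓ u = 0` off `p`: `ord_ℓ Δ_min` is unchanged by the unramified twist, tree
  `padicValInt_minimalDiscriminantInt_eq_of_twist_pStar`; a rational with all orders zero is `±1`).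
* §2 `maninConstant_dvd_of_isIsogenous_twist_pStar_of_padicValInt_lt_six` — **the transport on the
  reducible locus**: `W ∼ W₀ ⊗ χ_{p*}`, `ord_p Δ_min(W₀) < 6`, `N(W) = N(W₀)`, `p² ∣ N(W₀)`, `D`
  lattice-optimal ⟹ `c(D) ∣ c(D₀)`. NO irreducibility, NO optimality of `D₀`.
* §3 transfers along `W ∼ W₀ ⊗ χ_{p*}` with `N(W₀) = N(W)`: `sq_dvd_conductorNorm_iff_of_smul_twist_pStar`
  (`r² ∣ N` is unchanged by `χ_{p*}` at `r ≠ p`), `isIsogenous_twist_of_isIsogenous_twist_pStar` (twists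
  commute and compose), and the two GLOBAL TWIST-MINIMALITY clauses of the route's frame p587193 —
  `oddTwistMinimal_of_isIsogenous_twist_pStar` (granted modularity) and
  `dyadicTwistMinimal_of_isIsogenous_twist_pStar`.

HONEST STATUS: unconditional tree theorems (§3's odd clause takes modularity `exists_isNewformOf` as a
hypothesis); `--supports … --as helper`; nothing is closed. Nothing here proves BSD, Manin's conjecture
or C5. Seat bsd-line-ml23-c5-p1-w2 (width prover, gen 2).

References: [Stevens1989] Lemmas (5.2), (5.4); [Pal2012] Prop. 2.5, Lemma 3.1; [SilvermanAEC2009] VII.1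
Prop. 1.3, VIII.8 Cor. 8.3, X.5 Cor. 5.4; [SilvermanATAEC1994] IV.9.4, IV.10.4 and Exercise 4.40, Table 4.1.
-/

set_option autoImplicit false
-- the Theorems namespace of this sub repeats the summit name by design (D-0017 nested layout)
set_option linter.dupNamespace false

noncomputable section

open scoped Classical NumberField

namespace Summit.BirchSwinnertonDyer.BirchSwinnertonDyer.Theorems

open WeierstrassCurve IsDedekindDomain IsDedekindDomain.HeightOneSpectrum Rat.HeightOneSpectrum NumberField
  Literature.NumberTheory.EllipticCurves Literature.NumberTheory.EllipticCurves.ModularForms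
  Literature.NumberTheory.EllipticCurves.Rank1Residual
  Literature.NumberTheory.DiophantineGeometry
  Summit.BirchSwinnertonDyer.Rank1Residual.ManinAdditive
  Summit.BirchSwinnertonDyer.Rank1Residual.Additive

/-! ## §1 The minimal discriminant of the `χ_{p*}`-twist of a curve with `ord_p Δ_min < 6` -/

/-- **`Δ(C) = (p*)⁶·Δ(W₀)` for every globally minimal model `C = u • (W₀ ⊗ χ_{p*})`, `W₀` globally
minimal with `ord_p Δ_min(W₀) < 6`, `p` odd.** All valuations of the scaling `u` vanish (at `p`:
`padicValRat_u_eq_zero_of_twist_pm_p_of_lt_six`; off `p`: `ord_ℓ Δ_min(C) = ord_ℓ Δ_min(W₀)`,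
`padicValInt_minimalDiscriminantInt_eq_of_twist_pStar`, against `Δ(C) = u⁻¹²(p*)⁶Δ(W₀)`), so `u = ±1`.
This is the discriminant clause of `TwistOrbitManinTransport` (Pal 2012 Prop. 2.5, `ũ = 1`).
[cite: SilvermanAEC2009, VII.1 Prop. 1.3(b) and VIII.8] [cite: Pal2012, Prop. 2.5] -/
theorem Δ_eq_pStar_pow_six_mul_Δ_of_padicValInt_lt_six {p : ℕ} [Fact p.Prime] (hp2 : p ≠ 2)
    (W₀ C : WeierstrassCurve ℚ) [W₀.IsElliptic] [W₀.IsGloballyMinimal] [C.IsElliptic] [C.IsGloballyMinimal]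
    (hW₀ : padicValInt p W₀.minimalDiscriminantInt < 6) (u : VariableChange ℚ)
    (hu : u • W₀.quadraticTwist ((((-1 : ℤ) ^ (p / 2) * p : ℤ)) : ℚ) = C) :
    C.Δ = ((((-1 : ℤ) ^ (p / 2) * p : ℤ)) : ℚ) ^ 6 * W₀.Δ := by
  have hp : p.Prime := Fact.out
  obtain ⟨-, hd⟩ := pStar_intCast p
  set d : ℤ := (-1 : ℤ) ^ (p / 2) * p with hddef
  have hd0 : (d : ℚ) ≠ 0 := by
    rcases hd with h | h <;> rw [h] <;> push_cast <;> simp [hp.ne_zero]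
  have hx0 : (u.u : ℚ) ≠ 0 := u.u.ne_zero
  -- `Δ(C) = u⁻¹² d⁶ Δ(W₀)`
  have hΔ : C.Δ = (u.u : ℚ)⁻¹ ^ 12 * ((d : ℚ) ^ 6 * W₀.Δ) := by
    rw [← hu, variableChange_Δ, quadraticTwist_Δ, Units.val_inv_eq_inv_val]
  -- every valuation of `u` vanishes
  have hval : ∀ ℓ : ℕ, ℓ.Prime → padicValRat ℓ (u.u : ℚ) = 0 := by
    intro ℓ hℓ
    by_cases hℓp : ℓ = p
    · rw [hℓp]
      exact padicValRat_u_eq_zero_of_twist_pm_p_of_lt_six p hp2 W₀ C hW₀ hd u hu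
    · haveI : Fact ℓ.Prime := ⟨hℓ⟩
      obtain ⟨k, hk⟩ := exists_four_mul_add_one_eq_pStar p hp2
      have hmin : padicValInt ℓ C.minimalDiscriminantInt = padicValInt ℓ W₀.minimalDiscriminantInt :=
        padicValInt_minimalDiscriminantInt_eq_of_twist_pStar p W₀ hk.symm hd u hu hℓp
      have hW₀Δ : (W₀.minimalDiscriminantInt : ℚ) ≠ 0 := by
        exact_mod_cast W₀.minimalDiscriminantInt_ne_zero
      have hdv : padicValRat ℓ (d : ℚ) = 0 := by
        have hℓp' : padicValNat ℓ p = 0 := by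
          haveI : Fact p.Prime := ⟨hp⟩
          exact padicValNat_primes hℓp
        rcases hd with h | h <;> rw [h] <;> push_cast
        · rw [padicValRat.of_nat]; exact_mod_cast hℓp'
        · rw [padicValRat.neg, padicValRat.of_nat]; exact_mod_cast hℓp'
      have key : (padicValInt ℓ C.minimalDiscriminantInt : ℤ) =
          padicValRat ℓ ((u.u : ℚ)⁻¹ ^ 12 * ((d : ℚ) ^ 6 * W₀.minimalDiscriminantInt)) := by
        rw [← padicValRat.of_int, cast_minimalDiscriminantInt, hΔ, cast_minimalDiscriminantInt]
      rw [padicValRat.mul (pow_ne_zero _ (inv_ne_zero hx0)) (mul_ne_zero (pow_ne_zero _ hd0) hW₀Δ),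
        padicValRat.mul (pow_ne_zero _ hd0) hW₀Δ, padicValRat.pow, padicValRat.pow, padicValRat.inv,
        hdv, padicValRat.of_int, hmin] at key
      simp only [mul_zero, zero_add] at key
      push_cast at key
      linarith
  rcases Literature.NumberTheory.DiophantineGeometry.Dioph.eq_one_or_eq_neg_one_of_padicValRat_eq_zero hx0
      hval with h1 | h1 <;>
    rw [hΔ, h1] <;> norm_num

/-! ## §2 The irreducibility-free transport `c(D) ∣ c(D₀)` -/

/-- **Manin transport on a `χ_{p*}`-orbit, NO irreducibility** (`p ≥ 5` odd prime): `W₀/ℚ` globally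
minimal with `ord_p Δ_min(W₀) < 6` and ANY conductor-level datum `D₀`; `W/ℚ` globally minimal,
`W ∼ W₀ ⊗ χ_{p*}`, `N(W) = N(W₀)`, `p² ∣ N(W₀)`, `D` a LATTICE-OPTIMAL conductor-level datum of `W`:
`c(D) ∣ c(D₀)`. Proof: a globally minimal model `C = u • (W₀ ⊗ χ_{p*})` exists (Néron), `C ∼ W`, and
`Δ(C) = (p*)⁶ Δ(W₀)` (§1); then clause 1 of the an-cell's PROVED `twistOrbitManinTransport_pStar`
(Stevens (5.2)/(5.4): `Λ_C = g(χ)⁻¹Λ_{W₀}`, `maninConstant_dvd_of_charTwist_gamma0`).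
[cite: Stevens1989, Lemmas (5.2), (5.4)] [cite: Pal2012, Lemma 3.1] [cite: SilvermanAEC2009, VIII.8 Cor. 8.3] -/
theorem maninConstant_dvd_of_isIsogenous_twist_pStar_of_padicValInt_lt_six {p : ℕ} [Fact p.Prime]
    (hp2 : p ≠ 2) (W₀ W : WeierstrassCurve ℚ) [W₀.IsElliptic] [W₀.IsGloballyMinimal] [W.IsElliptic]
    [W.IsGloballyMinimal] [NeZero (W₀.conductorNorm ℤ)] [NeZero (W.conductorNorm ℤ)]
    (D₀ : ModularParametrizationData W₀ (W₀.conductorNorm ℤ))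
    (D : ModularParametrizationData W (W.conductorNorm ℤ)) (hD : IsLatticeOptimal D)
    (hpN₀ : p ^ 2 ∣ W₀.conductorNorm ℤ) (hN : W.conductorNorm ℤ = W₀.conductorNorm ℤ)
    (htw : IsIsogenous W (W₀.quadraticTwist ((((-1 : ℤ) ^ (p / 2) * p : ℤ)) : ℚ)))
    (hW₀ : padicValInt p W₀.minimalDiscriminantInt < 6) :
    D.c ∣ D₀.c := by
  have hp : p.Prime := Fact.out
  have hd0 : ((((-1 : ℤ) ^ (p / 2) * p : ℤ)) : ℚ) ≠ 0 := by
    push_cast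
    exact mul_ne_zero (pow_ne_zero _ (by norm_num)) (by exact_mod_cast hp.ne_zero)
  haveI : (W₀.quadraticTwist ((((-1 : ℤ) ^ (p / 2) * p : ℤ)) : ℚ)).IsElliptic := W₀.isElliptic_quadraticTwist hd0
  -- a globally minimal model `C` of the twist
  obtain ⟨u, hCmin⟩ := hasGlobalMinimalModel_rat_holds (W₀.quadraticTwist ((((-1 : ℤ) ^ (p / 2) * p : ℤ)) : ℚ))
  set C : WeierstrassCurve ℚ := u • W₀.quadraticTwist ((((-1 : ℤ) ^ (p / 2) * p : ℤ)) : ℚ) with hCdef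
  haveI : C.IsGloballyMinimal := hCmin
  have hiso : IsIsogenous C W :=
    ((isIsogenous_smul (W₀.quadraticTwist ((((-1 : ℤ) ^ (p / 2) * p : ℤ)) : ℚ)) u).symm_of_charZero).trans' htw.symm_of_charZero
  have hΔ : C.Δ = ((((-1 : ℤ) ^ (p / 2) * p : ℤ)) : ℚ) ^ 6 * W₀.Δ :=
    Δ_eq_pStar_pow_six_mul_Δ_of_padicValInt_lt_six hp2 W₀ C hW₀ u rfl
  exact (twistOrbitManinTransport_pStar hp hp2 W₀ W C u D₀ D hpN₀ hN rfl hiso hD).1 hΔ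

/-! ## §3 Transfers along `W ∼ W₀ ⊗ χ_{p*}` -/

/-- **`r² ∣ N(u • (W' ⊗ χ_{p*})) ↔ r² ∣ N(W')` for every prime `r ≠ p`** (`p` odd): the twist by
`p* ≡ 1 (mod 4)` is unramified at every place off `p`, so the conductor exponents there agree
(`Additive.conductorExponent_eq_of_twist_pStar_of_ne`). [cite: SilvermanATAEC1994, IV.9.4 and Exercise 4.40] -/
theorem sq_dvd_conductorNorm_iff_of_smul_twist_pStar {p : ℕ} [Fact p.Prime] (hp2 : p ≠ 2)
    (W' W'' : WeierstrassCurve ℚ) [W'.IsElliptic] [W''.IsElliptic] (u : VariableChange ℚ)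
    (hu : u • W'.quadraticTwist ((((-1 : ℤ) ^ (p / 2) * p : ℤ)) : ℚ) = W'') {r : ℕ} (hr : r.Prime) (hrp : r ≠ p) :
    r ^ 2 ∣ W''.conductorNorm ℤ ↔ r ^ 2 ∣ W'.conductorNorm ℤ := by
  obtain ⟨hcast, -⟩ := pStar_intCast p
  have hu' : u • W'.quadraticTwist ((-1 : ℚ) ^ (p / 2) * p) = W'' := by rw [← hcast]; exact hu
  have hgen : natGenerator ((primesEquiv (R := ℤ)).symm ⟨r, hr⟩) = r :=
    Literature.NumberTheory.EllipticCurves.Rat.natGenerator_primesEquiv_symm ⟨r, hr⟩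
  have hexp : W''.conductorExponent ((primesEquiv (R := ℤ)).symm ⟨r, hr⟩) =
      W'.conductorExponent ((primesEquiv (R := ℤ)).symm ⟨r, hr⟩) :=
    conductorExponent_eq_of_twist_pStar_of_ne p hp2 W' W'' u hu' _ (by rw [hgen]; exact hrp)
  rw [hr.pow_dvd_iff_le_factorization (conductorNorm_pos_holds W'').ne',
    hr.pow_dvd_iff_le_factorization (conductorNorm_pos_holds W').ne',
    factorization_conductorNorm_primesEquiv_symm W'' ⟨r, hr⟩,
    factorization_conductorNorm_primesEquiv_symm W' ⟨r, hr⟩, hexp]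

/-- **`W ∼ W₀ ⊗ χ_{p*}` and `W' ⊗ χ_e ∼ W₀` give `W ∼ (u • (W' ⊗ χ_{p*})) ⊗ χ_e`** — twists commute and
compose with isogenies and changes of variables. [cite: SilvermanAEC2009, X.5 Cor. 5.4] -/
theorem isIsogenous_twist_of_isIsogenous_twist_pStar {p : ℕ} [Fact p.Prime]
    {W W₀ W' : WeierstrassCurve ℚ} [W.IsElliptic] [W₀.IsElliptic] [W'.IsElliptic]
    (htw : IsIsogenous W (W₀.quadraticTwist ((((-1 : ℤ) ^ (p / 2) * p : ℤ)) : ℚ))) {e : ℚ}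
    (hiso₀ : IsIsogenous W₀ (W'.quadraticTwist e)) (u : VariableChange ℚ) :
    IsIsogenous W ((u • W'.quadraticTwist ((((-1 : ℤ) ^ (p / 2) * p : ℤ)) : ℚ)).quadraticTwist e) := by
  have hp : p.Prime := Fact.out
  have hd0 : ((((-1 : ℤ) ^ (p / 2) * p : ℤ)) : ℚ) ≠ 0 := by
    push_cast
    exact mul_ne_zero (pow_ne_zero _ (by norm_num)) (by exact_mod_cast hp.ne_zero)
  -- `W ∼ W₀ ⊗ p* ∼ (W' ⊗ e) ⊗ p* = (W' ⊗ p*) ⊗ e ∼ (u • (W' ⊗ p*)) ⊗ e`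
  have h1 : IsIsogenous W ((W'.quadraticTwist e).quadraticTwist ((((-1 : ℤ) ^ (p / 2) * p : ℤ)) : ℚ)) :=
    htw.trans' (hiso₀.quadraticTwist hd0)
  have h2 : (W'.quadraticTwist e).quadraticTwist ((((-1 : ℤ) ^ (p / 2) * p : ℤ)) : ℚ) =
      (W'.quadraticTwist ((((-1 : ℤ) ^ (p / 2) * p : ℤ)) : ℚ)).quadraticTwist e := by
    rw [quadraticTwist_quadraticTwist, quadraticTwist_quadraticTwist, mul_comm]
  rw [h2] at h1
  have h3 : IsIsogenous ((W'.quadraticTwist ((((-1 : ℤ) ^ (p / 2) * p : ℤ)) : ℚ)).quadraticTwist e)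
      ((u • W'.quadraticTwist ((((-1 : ℤ) ^ (p / 2) * p : ℤ)) : ℚ)).quadraticTwist e) := by
    rw [WeierstrassCurve.quadraticTwist_smul]
    exact isIsogenous_smul _ _
  exact h1.trans' h3

/-- **Transfer of the ODD twist-minimality clause along `W ∼ W₀ ⊗ χ_{p*}`** (granted modularity
`hnf`; `p` odd, `p² ∣ N(W)`, `N(W₀) = N(W)`): if no odd `χ_{q*}` semistable untwist exists for `W`, none
exists for `W₀`. For `q = p` a witness `W₀ ∼ W' ⊗ χ_{p*}` with `p² ∤ N(W')` gives `W ∼ W'` with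
`p² ∣ N(W) = N(W')`; for `q ≠ p` the globally minimal model of `W' ⊗ χ_{p*}` is a witness for `W`
(`q`-part of the conductor unchanged). [cite: SilvermanATAEC1994, IV.9.4 and Exercise 4.40]
[cite: SilvermanAEC2009, VIII.8 Cor. 8.3 and X.5 Cor. 5.4] -/
theorem oddTwistMinimal_of_isIsogenous_twist_pStar (hnf : exists_isNewformOf) {p : ℕ} [Fact p.Prime]
    (hp2 : p ≠ 2) {W W₀ : WeierstrassCurve ℚ} [W.IsElliptic] [W₀.IsElliptic]
    (htw : IsIsogenous W (W₀.quadraticTwist ((((-1 : ℤ) ^ (p / 2) * p : ℤ)) : ℚ))) (hpN : p ^ 2 ∣ W.conductorNorm ℤ)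
    (hNN : W₀.conductorNorm ℤ = W.conductorNorm ℤ)
    (hodd : ¬ (∃ (W' : WeierstrassCurve ℚ) (q : ℕ), W'.IsElliptic ∧ W'.IsGloballyMinimal ∧ q.Prime ∧
        q ≠ 2 ∧ q ^ 2 ∣ W.conductorNorm ℤ ∧
        IsIsogenous W (W'.quadraticTwist (((-1 : ℤ) ^ (q / 2) * q : ℤ) : ℚ)) ∧
        ¬ q ^ 2 ∣ W'.conductorNorm ℤ)) :
    ¬ (∃ (W' : WeierstrassCurve ℚ) (q : ℕ), W'.IsElliptic ∧ W'.IsGloballyMinimal ∧ q.Prime ∧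
        q ≠ 2 ∧ q ^ 2 ∣ W₀.conductorNorm ℤ ∧
        IsIsogenous W₀ (W'.quadraticTwist (((-1 : ℤ) ^ (q / 2) * q : ℤ) : ℚ)) ∧
        ¬ q ^ 2 ∣ W'.conductorNorm ℤ) := by
  have hp : p.Prime := Fact.out
  have hd0 : ((((-1 : ℤ) ^ (p / 2) * p : ℤ)) : ℚ) ≠ 0 := by
    push_cast
    exact mul_ne_zero (pow_ne_zero _ (by norm_num)) (by exact_mod_cast hp.ne_zero)
  rintro ⟨W', q, hE', hM', hq, hq2, hqN₀, hiso₀, hqN'⟩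
  by_cases hqp : q = p
  · subst q
    -- `W ∼ W₀ ⊗ p* ∼ (W' ⊗ p*) ⊗ p* ≅ W'`, so `N(W) = N(W')`: contradiction with `p² ∣ N(W)`
    haveI : (W'.quadraticTwist ((((-1 : ℤ) ^ (p / 2) * p : ℤ)) : ℚ)).IsElliptic := W'.isElliptic_quadraticTwist hd0
    haveI : ((W'.quadraticTwist ((((-1 : ℤ) ^ (p / 2) * p : ℤ)) : ℚ)).quadraticTwist ((((-1 : ℤ) ^ (p / 2) * p : ℤ)) : ℚ)).IsElliptic :=
      (W'.quadraticTwist ((((-1 : ℤ) ^ (p / 2) * p : ℤ)) : ℚ)).isElliptic_quadraticTwist hd0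
    obtain ⟨Cq, hCq⟩ := W'.exists_variableChange_smul_eq_quadraticTwist_sq hd0
    have h2 : IsIsogenous ((W'.quadraticTwist ((((-1 : ℤ) ^ (p / 2) * p : ℤ)) : ℚ)).quadraticTwist ((((-1 : ℤ) ^ (p / 2) * p : ℤ)) : ℚ)) W' := by
      rw [quadraticTwist_quadraticTwist, ← sq, ← hCq]
      exact (isIsogenous_smul _ _).symm_of_charZero
    have hWW' : IsIsogenous W W' := (htw.trans' (hiso₀.quadraticTwist hd0)).trans' h2
    have hN : W.conductorNorm ℤ = W'.conductorNorm ℤ :=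
      conductorNorm_eq_of_isIsogenous_of_modularity
        (nonempty_modularParametrizationData_of_exists_isNewformOf hnf
          IsNewformOf.exists_maninConstant_ne_zero_holds) _ _ hWW'
    exact hqN' (hN ▸ hpN)
  · -- `q ≠ p`: the globally minimal model of `W' ⊗ p*` is an odd untwist witness for `W` at `q`
    haveI : (W'.quadraticTwist ((((-1 : ℤ) ^ (p / 2) * p : ℤ)) : ℚ)).IsElliptic := W'.isElliptic_quadraticTwist hd0
    obtain ⟨u, hmin⟩ := hasGlobalMinimalModel_rat_holds (W'.quadraticTwist ((((-1 : ℤ) ^ (p / 2) * p : ℤ)) : ℚ))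
    refine hodd ⟨u • W'.quadraticTwist ((((-1 : ℤ) ^ (p / 2) * p : ℤ)) : ℚ), q, inferInstance, hmin, hq, hq2, hNN ▸ hqN₀,
      isIsogenous_twist_of_isIsogenous_twist_pStar htw hiso₀ u, fun h ↦ hqN' ?_⟩
    exact (sq_dvd_conductorNorm_iff_of_smul_twist_pStar hp2 W' _ u rfl hq hqp).mp h

/-- **Transfer of the DYADIC twist-minimality clause along `W ∼ W₀ ⊗ χ_{p*}`** (`p` odd,
`N(W₀) = N(W)`): a dyadic semistable untwist `W₀ ∼ W' ⊗ χ_d`, `d ∈ {−1, 2, −2}`, `4 ∤ N(W')`, would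
make the globally minimal model of `W' ⊗ χ_{p*}` one for `W` (the `2`-part of the conductor is
unchanged by `χ_{p*}`, `p* ≡ 1 (mod 4)`). [cite: SilvermanATAEC1994, IV.9.4 and Exercise 4.40]
[cite: SilvermanAEC2009, VIII.8 Cor. 8.3 and X.5 Cor. 5.4] -/
theorem dyadicTwistMinimal_of_isIsogenous_twist_pStar {p : ℕ} [Fact p.Prime] (hp2 : p ≠ 2)
    {W W₀ : WeierstrassCurve ℚ} [W.IsElliptic] [W₀.IsElliptic]
    (htw : IsIsogenous W (W₀.quadraticTwist ((((-1 : ℤ) ^ (p / 2) * p : ℤ)) : ℚ)))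
    (hNN : W₀.conductorNorm ℤ = W.conductorNorm ℤ)
    (hdy : ¬ (∃ (W' : WeierstrassCurve ℚ) (d : ℤ), W'.IsElliptic ∧ W'.IsGloballyMinimal ∧
        (d = -1 ∨ d = 2 ∨ d = -2) ∧ 2 ^ 2 ∣ W.conductorNorm ℤ ∧
        IsIsogenous W (W'.quadraticTwist (d : ℚ)) ∧ ¬ 2 ^ 2 ∣ W'.conductorNorm ℤ)) :
    ¬ (∃ (W' : WeierstrassCurve ℚ) (d : ℤ), W'.IsElliptic ∧ W'.IsGloballyMinimal ∧
        (d = -1 ∨ d = 2 ∨ d = -2) ∧ 2 ^ 2 ∣ W₀.conductorNorm ℤ ∧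
        IsIsogenous W₀ (W'.quadraticTwist (d : ℚ)) ∧ ¬ 2 ^ 2 ∣ W'.conductorNorm ℤ) := by
  have hp : p.Prime := Fact.out
  have hd0 : ((((-1 : ℤ) ^ (p / 2) * p : ℤ)) : ℚ) ≠ 0 := by
    push_cast
    exact mul_ne_zero (pow_ne_zero _ (by norm_num)) (by exact_mod_cast hp.ne_zero)
  rintro ⟨W', d, hE', hM', hd, h4N₀, hiso₀, h4N'⟩
  haveI : (W'.quadraticTwist ((((-1 : ℤ) ^ (p / 2) * p : ℤ)) : ℚ)).IsElliptic := W'.isElliptic_quadraticTwist hd0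
  obtain ⟨u, hmin⟩ := hasGlobalMinimalModel_rat_holds (W'.quadraticTwist ((((-1 : ℤ) ^ (p / 2) * p : ℤ)) : ℚ))
  refine hdy ⟨u • W'.quadraticTwist ((((-1 : ℤ) ^ (p / 2) * p : ℤ)) : ℚ), d, inferInstance, hmin, hd, hNN ▸ h4N₀,
    isIsogenous_twist_of_isIsogenous_twist_pStar htw hiso₀ u, fun h ↦ h4N' ?_⟩
  exact (sq_dvd_conductorNorm_iff_of_smul_twist_pStar hp2 W' _ u rfl Nat.prime_two
    (fun h2 ↦ hp2 h2.symm)).mp h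

end Summit.BirchSwinnertonDyer.BirchSwinnertonDyer.Theorems

end
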